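import Mathlib
import Summits.CriticalPhenomena.CardyFormulaZ2.Theorems.CardyMagicRigidityPositiveConeDefs
import Summits.CriticalPhenomena.CardyFormulaZ2.Theorems.CardyMagicRigidityNestingRigidityCloudAdmissibility
import Literature.Probability.Percolation.NestingPhaseEstimates
import HarnessLib

/-!
# Crux `NestingRigidity`, line `ring-cloud-tomography` (r3): the STAIRCASE CLOUD of stub R2
# `stub_partnerTilt` — sign of the weight, the cloud, the bite classification, and R2 modulo the loop side

Crux `Summit.CriticalPhenomena.CardyFormulaZ2.Theses.CardyMagicRigidity.NestingRigidity`
(stmt-CriticalPhenomena-4835), line `ring-cloud-tomography`, skeleton r3, stub R2 `stub_partnerTilt`: the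
cone sandwich at the PARTNER charges `t ∈ (−5π/6, −π/2)`.  The tower weight `w(t) = magicWeight t =
2cos(t + π/3)` is `≥ 0` exactly on `[−5π/6, π/6]` (§1), so a single neutralising ring (charge `−t > π/6`)
would produce signed weights; the line's device is the STAIRCASE CLOUD — bump `(0, r, t)` plus `k` rings
`(0, L j, M j)` of charge `−t/k ≤ π/6`: `Cloud.mk 1 k (fun _ ↦ 0) (fun _ ↦ r) (fun _ ↦ t) (fun _ ↦ 0) L M
(fun _ ↦ -t / k)` (pinned to `𝔠` by `h𝔠` in §4–§6).  Proved here (no cited facts, no definitions):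
* §1 `w ≥ 0` on `[−5π/6, π/6]`, `w < 0` on `(π/6, 7π/6)`; §2 (private; = `ConeTilt.*` of `…ConeTiltLoopSide`,
  unbuilt on the hub at check time) carrier fractions, bite formula; §3 winding constancy off the trace;
* §4 the staircase is ADMISSIBLE (`k ≥ 1`, `0 < r ≤ L j`, `0 < L j < M j`, `M j ≤ L l` for `j < l`), its phase
  is `θ_u = tφ₀ + (−t/k)Σ_j φ_j`, its energy is `t² log r + C` with an EXPLICIT `r`-free `C` (the bump sits in
  every hole), so under the cloud law `E_δ[A_𝔠] → e^{βC} r^{βt²}`;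
* §5 THE CLASSIFICATION (registered: `staircase_nestingFactor_nonneg_or_cross`): for `t ∈ [−5π/6, 0]`,
  `−t ≤ kπ/6`, every loop has phase in `[−5π/6, π/6]`, hence weight `≥ 0`, UNLESS its trace meets
  `B̄(0, M j₁)` and `B(0, L j₂)ᶜ` for rings `j₁ < j₂` (it crosses a gap: a polychromatic two-arm event);
* §6 rings outside the unit window (`1 ≤ L j`): inner loops bite no ring, TOWER loops weigh exactly `w(t)`
  (whence `A_𝔠 = w(t)^{N_0(r,1)} ∏ᶠ_{u ∉ tower} w_u` on both lattices by `ConeTilt.nestingWeight_eq_pow_mul_finprod`);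
* §7 R2 MODULO THE LOOP SIDE (`partnerTilt_of_decoupling`): the cloud law plus the HYPOTHESIS
  `StaircaseUVDecoupling E` (some staircase has `r^{η} T ≤ E_δ[A_𝔠] ≤ r^{−η} T` for small `r`, then small `δ`,
  `T = towerMoment · exp(√3 t · meanTower)`) give the sandwich of `stub_partnerTilt`.  That hypothesis — RSW
  separation of scales: the signed gap-crossing factor pairs positively with the non-negative inner
  functional of §5, and the UV drift concentrates — is absent from the tree and NOT asserted.
-/

noncomputable section

open MeasureTheory Set Filter Metric
open scoped Real Topology BigOperators

namespace Summit.CriticalPhenomena.CardyFormulaZ2.Cruxes.NestingRigidity.RingCloudTomography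

open Literature.Probability.RandomPlanarGeometry Literature.Probability.Percolation
  Literature.Probability.LatticeModels
open Summit.CriticalPhenomena.CardyFormulaZ2.Cruxes.NestingRigidity.PositiveConeWeightDoubling
  (magicWeight beta meanTower)

namespace Staircase

/-! ## §1 The sign of the loop weight `w(θ) = 2cos(θ + π/3)` -/

/-- **The weight `w`** (`u.nestingFactor f = magicWeight (u.nestingPhase f)` definitionally) **is
non-negative on the long window** `θ ∈ [−5π/6, π/6]` (`θ + π/3 ∈ [−π/2, π/2]`). -/
theorem magicWeight_nonneg_of_mem_Icc {θ : ℝ} (hθ : θ ∈ Set.Icc (-(5 * π / 6)) (π / 6)) :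
    0 ≤ magicWeight θ :=
  mul_nonneg zero_le_two (Real.cos_nonneg_of_mem_Icc
    ⟨by linarith [hθ.1, Real.pi_pos], by linarith [hθ.2, Real.pi_pos]⟩)

/-- … and NEGATIVE on the complementary window `π/6 < θ < 7π/6` (mod `2π`). -/
theorem magicWeight_neg_of_lt_of_lt {θ : ℝ} (h₁ : π / 6 < θ) (h₂ : θ < 7 * π / 6) :
    magicWeight θ < 0 :=
  mul_neg_of_pos_of_neg zero_lt_two
    (Real.cos_neg_of_pi_div_two_lt_of_lt (by linarith) (by linarith))

/-! ## §2 Fractions of a carrier's mass inside a set; the bite formula -/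

/-- The disc density is non-negative. -/
private theorem discDensity_nonneg (x : ℂ) (r : ℝ) (z : ℂ) : 0 ≤ discDensity x r z :=
  Set.indicator_nonneg (fun _ _ ↦ by positivity) z

/-- The ring density is non-negative (for `0 ≤ L ≤ M`). -/
private theorem annulusDensity_nonneg (c : ℂ) {L M : ℝ} (hL : 0 ≤ L) (hLM : L ≤ M) (z : ℂ) :
    0 ≤ annulusDensity c L M z := by
  refine Set.indicator_nonneg (fun _ _ ↦ ?_) z
  have : 0 ≤ M ^ 2 - L ^ 2 := by nlinarith
  positivity

/-- The fraction of a disc's mass inside ANY set lies in `[0, 1]`. -/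
private theorem setIntegral_discDensity_mem_Icc (x : ℂ) {r : ℝ} (hr : 0 < r) (U : Set ℂ) :
    ∫ z in U, discDensity x r z ∈ Set.Icc (0 : ℝ) 1 := by
  refine ⟨integral_nonneg fun z ↦ discDensity_nonneg x r z, ?_⟩
  rw [← CloudAdmissibility.integral_discDensity x hr]
  exact setIntegral_le_integral (CloudAdmissibility.integrable_discDensity x r)
    (Eventually.of_forall fun z ↦ discDensity_nonneg x r z)

/-- The fraction of a ring's mass inside ANY set lies in `[0, 1]`. -/
private theorem setIntegral_annulusDensity_mem_Icc (c : ℂ) {L M : ℝ} (hL : 0 < L) (hLM : L < M) (U : Set ℂ) :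
    ∫ z in U, annulusDensity c L M z ∈ Set.Icc (0 : ℝ) 1 := by
  refine ⟨integral_nonneg fun z ↦ annulusDensity_nonneg c hL.le hLM.le z, ?_⟩
  rw [← CloudAdmissibility.integral_annulusDensity c hL hLM]
  exact setIntegral_le_integral (CloudAdmissibility.integrable_annulusDensity c L M)
    (Eventually.of_forall fun z ↦ annulusDensity_nonneg c hL.le hLM.le z)

/-- A disc inside the set has all its mass inside (fraction `1`) … -/
private theorem setIntegral_discDensity_eq_one (x : ℂ) {r : ℝ} (hr : 0 < r) {U : Set ℂ}
    (hU : ball x r ⊆ U) : ∫ z in U, discDensity x r z = 1 := by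
  rw [setIntegral_eq_integral_of_forall_compl_eq_zero fun z hz ↦ ?_,
    CloudAdmissibility.integral_discDensity x hr]
  exact Set.indicator_of_notMem (fun h ↦ hz (hU h)) _

/-- … and a ring outside the set has none (fraction `0`). -/
private theorem setIntegral_annulusDensity_eq_zero (c : ℂ) (L M : ℝ) {U : Set ℂ}
    (hU : Disjoint U {z : ℂ | L ≤ ‖z - c‖ ∧ ‖z - c‖ < M}) : ∫ z in U, annulusDensity c L M z = 0 :=
  setIntegral_eq_zero_of_forall_eq_zero fun _ hz ↦ Set.indicator_of_notMem (Set.disjoint_left.1 hU hz) _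

/-- **Bite formula** (any cloud): the phase `∫_{W(u,·) ≠ 0} f` of a loop is the sum over the carriers of
(charge) × (fraction of the carrier's mass inside the winding interior). -/
private theorem nestingPhase_density (𝔠 : Cloud) (u : UnbasedLoop ℂ) :
    u.nestingPhase 𝔠.density =
      (∑ i, 𝔠.a i * ∫ z in {z | u.wind z ≠ 0}, discDensity (𝔠.x i) (𝔠.r i) z) +
        ∑ k, 𝔠.g k * ∫ z in {z | u.wind z ≠ 0}, annulusDensity (𝔠.c k) (𝔠.L k) (𝔠.M k) z := by
  have h1 : ∀ i, Integrable (fun z ↦ 𝔠.a i * discDensity (𝔠.x i) (𝔠.r i) z)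
      (volume.restrict {z | u.wind z ≠ 0}) := fun i ↦
    ((CloudAdmissibility.integrable_discDensity _ _).const_mul _).restrict
  have h2 : ∀ k, Integrable (fun z ↦ 𝔠.g k * annulusDensity (𝔠.c k) (𝔠.L k) (𝔠.M k) z)
      (volume.restrict {z | u.wind z ≠ 0}) := fun k ↦
    ((CloudAdmissibility.integrable_annulusDensity _ _ _).const_mul _).restrict
  unfold UnbasedLoop.nestingPhase Cloud.density
  rw [integral_add (integrable_finsetSum _ fun i _ ↦ h1 i) (integrable_finsetSum _ fun k _ ↦ h2 k),
    integral_finsetSum _ fun i _ ↦ h1 i, integral_finsetSum _ fun k _ ↦ h2 k]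
  simp only [integral_const_mul]

/-! ## §3 Winding constancy on a disc missing the trace -/

/-- **Winding constancy on a closed disc missing the trace** (`UnbasedLoop.wind_eq_wind_of_disjoint`):
so a loop whose interior meets a ring it does not touch contains the whole ring AND ITS HOLE. -/
theorem wind_eq_of_range_subset_compl {u : UnbasedLoop ℂ} {R : ℝ}
    (hu : u.range ⊆ (closedBall (0 : ℂ) R)ᶜ) {z w : ℂ} (hz : z ∈ closedBall (0 : ℂ) R)
    (hw : w ∈ closedBall (0 : ℂ) R) : u.wind z = u.wind w :=
  u.wind_eq_wind_of_disjoint (Set.disjoint_left.2 fun _ hx hx' ↦ hu hx hx') hz hw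

/-- **A loop inside `B(0, R)` does not wind around points of norm `≥ R`** (it bites no outer ring). -/
theorem wind_eq_zero_of_range_subset_ball {u : UnbasedLoop ℂ} {R : ℝ} (hu : u.range ⊆ ball (0 : ℂ) R)
    {z : ℂ} (hz : R ≤ ‖z‖) : u.wind z = 0 :=
  u.wind_eq_zero_of_subset_ball hu (by rwa [dist_zero_right])

/-! ## §4 The staircase cloud `𝔠` (pinned by `h𝔠`; instantiate with `rfl`): admissibility, phase, energy -/

section StaircaseCloud

variable {𝔠 : Cloud} {t r : ℝ} {k : ℕ} {L M : Fin k → ℝ}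
  (h𝔠 : 𝔠 = Cloud.mk 1 k (fun _ ↦ 0) (fun _ ↦ r) (fun _ ↦ t) (fun _ ↦ 0) L M (fun _ ↦ -t / k))
include h𝔠

/-- **The staircase cloud is admissible** as soon as `k ≥ 1`, `0 < r ≤ L j`, `0 < L j < M j` and the
rings are separated (`M j ≤ L l` for `j < l`): the bump sits in every hole, the rings are nested. -/
theorem admissible (hk : 0 < k) (hr : 0 < r) (hrL : ∀ j, r ≤ L j) (hL : ∀ j, 0 < L j)
    (hLM : ∀ j, L j < M j) (hsep : ∀ j l, j < l → M j ≤ L l) : 𝔠.Admissible := by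
  subst h𝔠
  refine ⟨fun _ ↦ hr, hL, hLM, ?_, fun i j hij ↦ absurd (Subsingleton.elim i j) hij,
    fun _ j ↦ Or.inl (by simpa using hrL j), fun j l hjl ↦ ?_⟩
  · rw [Fin.sum_univ_one, Finset.sum_const, Finset.card_univ, Fintype.card_fin, nsmul_eq_mul,
      mul_div_cancel₀ _ (Nat.cast_ne_zero.2 hk.ne' : (k : ℝ) ≠ 0), add_neg_cancel]
  · rcases lt_or_gt_of_ne hjl with h | h
    · exact Or.inl (by simpa using hsep j l h)
    · exact Or.inr (Or.inl (by simpa using hsep l j h))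

/-- **Bite formula for the staircase**: the phase of a loop is `t φ₀ + (−t/k) Σ_j φ_j`, `φ₀` the
fraction of the bump's mass and `φ_j` the fraction of ring `j`'s mass inside the winding interior. -/
theorem nestingPhase_eq (u : UnbasedLoop ℂ) :
    u.nestingPhase 𝔠.density =
      t * (∫ z in {z | u.wind z ≠ 0}, discDensity 0 r z) +
        -t / k * ∑ j, ∫ z in {z | u.wind z ≠ 0}, annulusDensity 0 (L j) (M j) z := by
  subst h𝔠; rw [nestingPhase_density]; simp [Finset.mul_sum]

/-- **The Gaussian exponent of the staircase, explicitly**: `t² log r` plus an `r`-FREE constant (disc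
self-energy `t²(log r − 1/4)`; position-free `ringHolePotential` bump–ring terms as `r ≤ L j`). -/
theorem energy_eq (hrL : ∀ j, r ≤ L j) :
    𝔠.energy = t ^ 2 * Real.log r +
      (-(t ^ 2 / 4) + 2 * ∑ j, t * (-t / k) * ringHolePotential (L j) (M j) +
        ∑ j, ∑ l, -t / k * (-t / k) *
          (if j = l then ringSelfEnergy (L j) (M j)
            else if M j ≤ L l then ringHolePotential (L l) (M l)
            else if M l ≤ L j then ringHolePotential (L j) (M j) else 0)) := by
  subst h𝔠; simp [Cloud.energy, discSelfEnergy, hrL]; ring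

/-- **The Gaussian side at the staircase**: under the cloud law of `E`, for an admissible staircase
`E_δ[A_𝔠] → e^{βC} · r^{βt²}` as `δ → 0⁺`, `C = 𝔠.energy − t² log r` the `r`-FREE constant of `energy_eq`. -/
theorem tendsto_nestingWeight {E : LoopEnsemble} (hE : E.CloudLaw) (hk : 0 < k) (hr : 0 < r)
    (hrL : ∀ j, r ≤ L j) (hL : ∀ j, 0 < L j) (hLM : ∀ j, L j < M j)
    (hsep : ∀ j l, j < l → M j ≤ L l) :
    Tendsto (fun δ : ℝ ↦ ∫ ω, (E.X δ ω).nestingWeight 𝔠.density ∂E.P) (𝓝[>] 0)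
      (𝓝 (Real.exp (beta * (𝔠.energy - t ^ 2 * Real.log r)) * r ^ (beta * t ^ 2))) := by
  convert hE 𝔠 (admissible h𝔠 hk hr hrL hL hLM hsep) using 3
  rw [Real.rpow_def_of_pos hr, ← Real.exp_add, beta]
  ring_nf

/-! ## §5 The classification of loop phases against the staircase -/

/-- **Every phase is `≥ t`** (`t ≤ 0`): `θ_u = tφ₀ + (−t/k)Σ_j φ_j ≥ t` since `φ₀ ≤ 1`, `φ_j ≥ 0`. -/
theorem le_nestingPhase (ht : t ≤ 0) (hr : 0 < r) (hL : ∀ j, 0 < L j) (hLM : ∀ j, L j < M j)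
    (u : UnbasedLoop ℂ) : t ≤ u.nestingPhase 𝔠.density := by
  rw [nestingPhase_eq h𝔠]
  have h₀ := setIntegral_discDensity_mem_Icc 0 hr {z | u.wind z ≠ 0}
  have h₁ : 0 ≤ ∑ j, ∫ z in {z | u.wind z ≠ 0}, annulusDensity 0 (L j) (M j) z :=
    Finset.sum_nonneg fun j _ ↦ (setIntegral_annulusDensity_mem_Icc 0 (hL j) (hLM j) _).1
  have hg : 0 ≤ -t / k := div_nonneg (neg_nonneg.2 ht) (Nat.cast_nonneg k)
  nlinarith [h₀.1, h₀.2, mul_nonneg hg h₁]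

/-- **THE CLASSIFICATION (phase form).** For the staircase with `t ≤ 0`, ring charges `−t/k ≤ π/6`
and the bump inside every ring (`r ≤ L j`), a loop has phase `≤ π/6` UNLESS its trace meets `B̄(0, M j₁)`
and leaves `B(0, L j₂)` for two rings `j₁ < j₂`.  Proof: `θ_u > π/6 ≥ −t/k` forces `Σ_j φ_j > 1`, so two
rings `j₁ < j₂` are bitten; if the trace missed `B̄(0, M j₁)` the winding number would be constant there,
non-zero on the bitten ring `j₁`, so the bump is swallowed (`φ₀ = 1`) and `θ_u ≤ t + (−t/k)·k = 0`; if
the trace stayed inside `B(0, L j₂)`, ring `j₂` would not be bitten. -/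
theorem nestingPhase_le_or_cross (ht : t ≤ 0) (htk : -t ≤ k * (π / 6)) (hr : 0 < r)
    (hrL : ∀ j, r ≤ L j) (hL : ∀ j, 0 < L j) (hLM : ∀ j, L j < M j) (u : UnbasedLoop ℂ) :
    u.nestingPhase 𝔠.density ≤ π / 6 ∨
      ∃ j₁ j₂, j₁ < j₂ ∧ (u.range ∩ closedBall (0 : ℂ) (M j₁)).Nonempty ∧
        (u.range ∩ (ball (0 : ℂ) (L j₂))ᶜ).Nonempty := by
  set U : Set ℂ := {z | u.wind z ≠ 0}
  set φ₀ : ℝ := ∫ z in U, discDensity 0 r z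
  set φ : Fin k → ℝ := fun j ↦ ∫ z in U, annulusDensity 0 (L j) (M j) z
  have hθ : u.nestingPhase 𝔠.density = t * φ₀ + -t / k * ∑ j, φ j := nestingPhase_eq h𝔠 u
  have h₀ : φ₀ ∈ Set.Icc (0 : ℝ) 1 := setIntegral_discDensity_mem_Icc 0 hr U
  have h₁ : ∀ j, φ j ∈ Set.Icc (0 : ℝ) 1 := fun j ↦ setIntegral_annulusDensity_mem_Icc 0 (hL j) (hLM j) U
  have hg : 0 ≤ -t / k := div_nonneg (neg_nonneg.2 ht) (Nat.cast_nonneg k)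
  have hπ6 : (0 : ℝ) < π / 6 := by positivity
  by_cases hcross : ∃ j₁ j₂, j₁ < j₂ ∧ (u.range ∩ closedBall (0 : ℂ) (M j₁)).Nonempty ∧
      (u.range ∩ (ball (0 : ℂ) (L j₂))ᶜ).Nonempty
  · exact Or.inr hcross
  refine Or.inl (not_lt.1 fun hgt ↦ ?_)
  rw [hθ] at hgt
  -- two rings bitten with positive fractions is impossible without a gap crossing
  have key : ∀ j₁ j₂, j₁ < j₂ → 0 < φ j₁ → 0 < φ j₂ → False := by
    intro j₁ j₂ hlt hp₁ hp₂
    by_cases hA : (u.range ∩ closedBall (0 : ℂ) (M j₁)).Nonempty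
    · by_cases hB : (u.range ∩ (ball (0 : ℂ) (L j₂))ᶜ).Nonempty
      · exact hcross ⟨j₁, j₂, hlt, hA, hB⟩
      · -- the trace stays inside `B(0, L j₂)`: ring `j₂` is not bitten
        have hsub : u.range ⊆ ball (0 : ℂ) (L j₂) := fun x hx ↦ by_contra fun h ↦ hB ⟨x, hx, h⟩
        exact hp₂.ne' (setIntegral_annulusDensity_eq_zero 0 (L j₂) (M j₂) (Set.disjoint_left.2
          fun z hz hz' ↦ hz (wind_eq_zero_of_range_subset_ball hsub (by simpa using hz'.1))))
    · -- the trace misses `B̄(0, M j₁)`: constant winding there; ring `j₁` bitten ⇒ bump swallowed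
      have hsub : u.range ⊆ (closedBall (0 : ℂ) (M j₁))ᶜ := fun x hx hx' ↦ hA ⟨x, hx, hx'⟩
      obtain ⟨z, hzU, hz⟩ : (U ∩ {z : ℂ | L j₁ ≤ ‖z - 0‖ ∧ ‖z - 0‖ < M j₁}).Nonempty := by
        by_contra hem
        exact hp₁.ne' (setIntegral_annulusDensity_eq_zero 0 (L j₁) (M j₁)
          (Set.disjoint_iff_inter_eq_empty.2 (Set.not_nonempty_iff_eq_empty.1 hem)))
      have hzB : z ∈ closedBall (0 : ℂ) (M j₁) := mem_closedBall_zero_iff.2 (by simpa using hz.2.le)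
      have hφ₀1 : φ₀ = 1 := setIntegral_discDensity_eq_one 0 hr fun w hw ↦ by
        have hwB : w ∈ closedBall (0 : ℂ) (M j₁) :=
          mem_closedBall_zero_iff.2 (by linarith [hrL j₁, hLM j₁, mem_ball_zero_iff.1 hw])
        simpa only [U, mem_setOf_eq, wind_eq_of_range_subset_compl hsub hwB hzB] using hzU
      have hsum : ∑ j, φ j ≤ k :=
        (Finset.sum_le_sum fun j _ ↦ (h₁ j).2).trans (by simp)
      have hle : -t / k * ∑ j, φ j ≤ -t := (mul_le_mul_of_nonneg_left hsum hg).trans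
        (div_mul_cancel₀ _ (Nat.cast_pos.2 (Fin.pos j₁)).ne').le
      rw [hφ₀1, mul_one] at hgt
      linarith
  -- from `θ_u > π/6 ≥ −t/k`: the ring fractions sum to more than `1` …
  have hgk : -t / k ≤ π / 6 := by
    rcases Nat.eq_zero_or_pos k with hk | hk; · rw [hk, Nat.cast_zero, div_zero]; exact hπ6.le
    rw [div_le_iff₀ (Nat.cast_pos.2 hk)]; linarith
  have hsum1 : 1 < ∑ j, φ j := by
    by_contra hle
    have : -t / k * ∑ j, φ j ≤ π / 6 * 1 :=
      mul_le_mul hgk (not_lt.1 hle) (Finset.sum_nonneg fun j _ ↦ (h₁ j).1) hπ6.le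
    nlinarith [h₀.2, h₀.1]
  -- … hence two distinct rings have positive fractions
  obtain ⟨j, -, hj⟩ : ∃ j ∈ (Finset.univ : Finset (Fin k)), 0 < φ j := by
    by_contra h; push Not at h; linarith [Finset.sum_nonpos h]
  obtain ⟨j', hj'mem, hj'⟩ : ∃ j' ∈ Finset.univ.erase j, 0 < φ j' := by
    by_contra h; push Not at h
    linarith [(h₁ j).2, Finset.sum_nonpos h, Finset.add_sum_erase Finset.univ φ (Finset.mem_univ j)]
  rcases lt_or_gt_of_ne (Finset.ne_of_mem_erase hj'mem) with h | h
  · exact key j' j h hj' hj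
  · exact key j j' h hj hj'

/-- **The classification, weight form**: for `t ∈ [−5π/6, 0]` every loop has phase in the window
`[−5π/6, π/6]`, hence weight `≥ 0`, or it crosses a gap between two rings `j₁ < j₂` (so, `resolve_left`:
THE ONLY SIGNED LOOPS ARE GAP-CROSSING LOOPS, and products of non-crossing weights are `≥ 0`). -/
theorem nestingFactor_nonneg_or_cross (ht : t ∈ Set.Icc (-(5 * π / 6)) 0) (htk : -t ≤ k * (π / 6))
    (hr : 0 < r) (hrL : ∀ j, r ≤ L j) (hL : ∀ j, 0 < L j) (hLM : ∀ j, L j < M j) (u : UnbasedLoop ℂ) :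
    0 ≤ u.nestingFactor 𝔠.density ∨
      ∃ j₁ j₂, j₁ < j₂ ∧ (u.range ∩ closedBall (0 : ℂ) (M j₁)).Nonempty ∧
        (u.range ∩ (ball (0 : ℂ) (L j₂))ᶜ).Nonempty :=
  (nestingPhase_le_or_cross h𝔠 ht.2 htk hr hrL hL hLM u).imp_left fun h ↦
    magicWeight_nonneg_of_mem_Icc ⟨ht.1.trans (le_nestingPhase h𝔠 ht.2 hr hL hLM u), h⟩

/-! ## §6 Tower loops and inner loops (rings outside the unit window, `1 ≤ L j`) -/

/-- An inner loop (trace in `B(0, 1)`) bites no ring: its phase is `t φ₀`. -/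
theorem nestingPhase_of_range_subset (hL1 : ∀ j, 1 ≤ L j) {u : UnbasedLoop ℂ}
    (hu : u.range ⊆ ball (0 : ℂ) 1) :
    u.nestingPhase 𝔠.density = t * ∫ z in {z | u.wind z ≠ 0}, discDensity 0 r z := by
  rw [nestingPhase_eq h𝔠, Finset.sum_eq_zero fun j _ ↦ ?_, mul_zero, add_zero]
  refine setIntegral_annulusDensity_eq_zero 0 (L j) (M j) (Set.disjoint_left.2 fun z hz hz' ↦ hz ?_)
  exact wind_eq_zero_of_range_subset_ball hu ((hL1 j).trans (by simpa using hz'.1))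

/-- **Tower loops carry the full charge**: `B̄(0, r)` inside the winding interior and trace in the
unit window give phase exactly `t`, hence weight `w(t) = magicWeight t`. -/
theorem nestingFactor_of_tower (hr : 0 < r) (hL1 : ∀ j, 1 ≤ L j) {u : UnbasedLoop ℂ}
    (hU : closedBall (0 : ℂ) r ⊆ {z | u.wind z ≠ 0}) (hu : u.range ⊆ ball (0 : ℂ) 1) :
    u.nestingFactor 𝔠.density = magicWeight t := by
  rw [UnbasedLoop.nestingFactor, nestingPhase_of_range_subset h𝔠 hL1 hu,
    setIntegral_discDensity_eq_one 0 hr (ball_subset_closedBall.trans hU), mul_one, magicWeight]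

end StaircaseCloud

/-! ## §7 R2 modulo the loop-side estimate -/

/-- `r ↦ r^{s}` is small near `0⁺` (`s > 0`): below any `m > 0` on some `(0, r₁)` (private copy of
`PositiveConeWeightDoubling.exists_rpow_lt`, module `…ConeLever`, unbuilt on the hub at check time). -/
private theorem exists_rpow_lt {s m : ℝ} (hs : 0 < s) (hm : 0 < m) :
    ∃ r₁ : ℝ, 0 < r₁ ∧ ∀ r ∈ Set.Ioo (0 : ℝ) r₁, r ^ s < m := by
  have hc := (Real.continuousAt_rpow_const 0 s (Or.inr hs.le)).tendsto
  rw [Real.zero_rpow hs.ne'] at hc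
  obtain ⟨r₁, hr₁, hsub⟩ := mem_nhdsGT_iff_exists_Ioo_subset.1
    ((hc.mono_left nhdsWithin_le_nhds).eventually (gt_mem_nhds hm))
  exact ⟨r₁, hr₁, fun r hr ↦ hsub hr⟩

/-- **Stub R2 modulo the loop-side estimate.** For ANY ensemble with the cloud law, the staircase
UV-decoupling estimate `hdec` (`StaircaseUVDecoupling E`; a HYPOTHESIS, not proved here) implies the
sandwich of `stub_partnerTilt`: by `energy_eq` the Gaussian limit of `E_δ[A_𝔠]` is `K r^{βt²}` with ONE
constant `K = e^{βC}` for all `r < r₀`, absorbed into `r^{∓η/2}`. -/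
theorem partnerTilt_of_decoupling {E : LoopEnsemble} (hE : E.CloudLaw)
    (hdec : ∀ t ∈ Set.Ioo (-(5 * π / 6)) (-(π / 2)), ∀ η : ℝ, 0 < η →
      ∃ (k : ℕ) (L M : Fin k → ℝ) (r₀ : ℝ), 0 < k ∧ (∀ j, 0 < L j) ∧ (∀ j, L j < M j) ∧
        (∀ j l, j < l → M j ≤ L l) ∧ 0 < r₀ ∧ (∀ j, r₀ ≤ L j) ∧ ∀ r ∈ Set.Ioo (0 : ℝ) r₀,
          ∀ᶠ δ in 𝓝[>] (0 : ℝ),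
            r ^ η * (E.towerMoment (magicWeight t) δ r * Real.exp (Real.sqrt 3 * t * meanTower E δ r)) ≤
                ∫ ω, (E.X δ ω).nestingWeight (Cloud.mk 1 k (fun _ ↦ 0) (fun _ ↦ r) (fun _ ↦ t)
                  (fun _ ↦ 0) L M (fun _ ↦ -t / k)).density ∂E.P ∧
              ∫ ω, (E.X δ ω).nestingWeight (Cloud.mk 1 k (fun _ ↦ 0) (fun _ ↦ r) (fun _ ↦ t)
                  (fun _ ↦ 0) L M (fun _ ↦ -t / k)).density ∂E.P ≤
                r ^ (-η) * (E.towerMoment (magicWeight t) δ r * Real.exp (Real.sqrt 3 * t * meanTower E δ r))) :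
    ∀ t ∈ Set.Ioo (-(5 * π / 6)) (-(π / 2)), ∀ η : ℝ, 0 < η → ∃ r₀ : ℝ, 0 < r₀ ∧
      ∀ r ∈ Set.Ioo (0 : ℝ) r₀, ∀ᶠ δ in 𝓝[>] (0 : ℝ),
        r ^ (beta * t ^ 2 + η) ≤ E.towerMoment (magicWeight t) δ r * Real.exp (Real.sqrt 3 * t * meanTower E δ r) ∧
          E.towerMoment (magicWeight t) δ r * Real.exp (Real.sqrt 3 * t * meanTower E δ r) ≤
            r ^ (beta * t ^ 2 - η) := by
  intro t ht η hη
  obtain ⟨k, L, M, r₀, hk, hL, hLM, hsep, hr₀, hr₀L, hdec⟩ := hdec t ht (η / 2) (half_pos hη)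
  -- the staircase at radius `ρ`, and its `r`-free Gaussian constant read off at `ρ = r₀ / 2`
  set 𝔰 : ℝ → Cloud := fun ρ ↦ Cloud.mk 1 k (fun _ ↦ 0) (fun _ ↦ ρ) (fun _ ↦ t) (fun _ ↦ 0) L M (fun _ ↦ -t / k)
  set K : ℝ := Real.exp (beta * ((𝔰 (r₀ / 2)).energy - t ^ 2 * Real.log (r₀ / 2))) with hK
  have hK0 : 0 < K := Real.exp_pos _
  have hKr : ∀ r ∈ Set.Ioo (0 : ℝ) r₀, Real.exp (beta * ((𝔰 r).energy - t ^ 2 * Real.log r)) = K := by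
    refine fun r hr ↦ ?_
    rw [hK, energy_eq (𝔠 := 𝔰 r) rfl fun j ↦ (hr.2.le.trans (hr₀L j)),
      energy_eq (𝔠 := 𝔰 (r₀ / 2)) rfl fun j ↦ by linarith [hr₀L j]]
    ring_nf
  obtain ⟨r₁, hr₁, hsmall⟩ :=
    exists_rpow_lt (half_pos hη) (lt_min (half_pos hK0) (by positivity : 0 < 1 / (2 * K)))
  refine ⟨min r₀ r₁, lt_min hr₀ hr₁, fun r hr ↦ ?_⟩
  obtain ⟨hr0, hrr₀⟩ : 0 < r ∧ r ∈ Set.Ioo (0 : ℝ) r₀ := ⟨hr.1, hr.1, hr.2.trans_le (min_le_left _ _)⟩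
  have hrm : r ^ (η / 2) < min (K / 2) (1 / (2 * K)) := hsmall r ⟨hr0, hr.2.trans_le (min_le_right _ _)⟩
  have hG : Tendsto (fun δ : ℝ ↦ ∫ ω, (E.X δ ω).nestingWeight (𝔰 r).density ∂E.P) (𝓝[>] 0)
      (𝓝 (K * r ^ (beta * t ^ 2))) := hKr r hrr₀ ▸
    tendsto_nestingWeight (𝔠 := 𝔰 r) rfl hE hk hr0 (fun j ↦ hrr₀.2.le.trans (hr₀L j)) hL hLM hsep
  have hL0 : 0 < K * r ^ (beta * t ^ 2) := mul_pos hK0 (Real.rpow_pos_of_pos hr0 _)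
  filter_upwards [hdec r hrr₀, (tendsto_order.1 hG).1 _ (half_lt_self hL0),
    (tendsto_order.1 hG).2 _ (lt_two_mul_self hL0)] with δ hd hl hu
  obtain ⟨hρ, hd1, hd2⟩ : 0 < r ^ (η / 2) ∧ _ ∧ _ := ⟨Real.rpow_pos_of_pos hr0 _, hd⟩
  rw [Real.rpow_neg hr0.le] at hd2
  have e1 : r ^ (beta * t ^ 2 + η) = r ^ (beta * t ^ 2) * r ^ (η / 2) * r ^ (η / 2) := by
    rw [← Real.rpow_add hr0, ← Real.rpow_add hr0]; ring_nf
  have e2 : r ^ (beta * t ^ 2 - η) * (r ^ (η / 2) * r ^ (η / 2)) = r ^ (beta * t ^ 2) := by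
    rw [← Real.rpow_add hr0, ← Real.rpow_add hr0]; ring_nf
  set T := E.towerMoment (magicWeight t) δ r * Real.exp (Real.sqrt 3 * t * meanTower E δ r)
  set G := ∫ ω, (E.X δ ω).nestingWeight (𝔰 r).density ∂E.P
  constructor
  · have h1 : r ^ (η / 2) * G ≤ T := (le_inv_mul_iff₀ hρ).1 hd2
    have h2 : r ^ (η / 2) ≤ K / 2 := hrm.le.trans (min_le_left _ _)
    calc r ^ (beta * t ^ 2 + η) = r ^ (beta * t ^ 2) * r ^ (η / 2) * r ^ (η / 2) := e1
      _ ≤ r ^ (beta * t ^ 2) * (K / 2) * r ^ (η / 2) := by gcongr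
      _ = r ^ (η / 2) * (K * r ^ (beta * t ^ 2) / 2) := by ring
      _ ≤ r ^ (η / 2) * G := by gcongr
      _ ≤ T := h1
  · have h1 : T ≤ (r ^ (η / 2))⁻¹ * G := (le_inv_mul_iff₀ hρ).2 hd1
    have h2 : 2 * K ≤ (r ^ (η / 2))⁻¹ := by
      rw [le_inv_comm₀ (by positivity) hρ, ← one_div]
      exact hrm.le.trans (min_le_right _ _)
    calc T ≤ (r ^ (η / 2))⁻¹ * G := h1
      _ ≤ (r ^ (η / 2))⁻¹ * (2 * (K * r ^ (beta * t ^ 2))) := by gcongr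
      _ = (r ^ (η / 2))⁻¹ * (2 * K) * r ^ (beta * t ^ 2) := by ring
      _ ≤ (r ^ (η / 2))⁻¹ * (r ^ (η / 2))⁻¹ * r ^ (beta * t ^ 2) := by gcongr
      _ = r ^ (beta * t ^ 2 - η) := by rw [← e2]; field_simp

end Staircase

/-- **Bite classification for staircase clouds** (registered helper toward stub R2 `stub_partnerTilt`,
line `ring-cloud-tomography` r3): for the staircase with bump `(0, r, t)`, `t ∈ [−5π/6, 0]`, and `k` rings
`(0, L j, M j)` of charge `−t/k ≤ π/6` containing the bump (`0 < r ≤ L j < M j`), EVERY loop weight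
`2cos(θ_u + π/3)` is `≥ 0` unless the trace meets `B̄(0, M j₁)` AND `B(0, L j₂)ᶜ` for rings `j₁ < j₂`. -/
theorem staircase_nestingFactor_nonneg_or_cross : ∀ (t r : ℝ) (k : ℕ) (L M : Fin k → ℝ),
    t ∈ Set.Icc (-(5 * π / 6)) 0 → -t ≤ k * (π / 6) → 0 < r → (∀ j, r ≤ L j) → (∀ j, 0 < L j) →
    (∀ j, L j < M j) → ∀ u : UnbasedLoop ℂ,
      0 ≤ u.nestingFactor (Cloud.mk 1 k (fun _ ↦ 0) (fun _ ↦ r) (fun _ ↦ t) (fun _ ↦ 0) L M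
        (fun _ ↦ -t / k)).density ∨
      ∃ j₁ j₂, j₁ < j₂ ∧ (u.range ∩ Metric.closedBall (0 : ℂ) (M j₁)).Nonempty ∧
        (u.range ∩ (Metric.ball (0 : ℂ) (L j₂))ᶜ).Nonempty :=
  fun _ _ _ _ _ ht htk hr hrL hL hLM u ↦
    Staircase.nestingFactor_nonneg_or_cross rfl ht htk hr hrL hL hLM u

end Summit.CriticalPhenomena.CardyFormulaZ2.Cruxes.NestingRigidity.RingCloudTomography

end

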